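import Summits.ABC.IUTFork.Conditional.InhUniformBandFrey283
import Summits.ABC.IUTFork.Conditional.InhUniformBandReyssat151
import Summits.ABC.IUTFork.Conditional.AbcOfSGenuineKLicence
import Summits.ABC.IUTFork.Cor312ThetaSideClosedK
import Summits.ABC.IUTFork.Cor312SettingDHVolWitness
import Summits.ABC.IUTFork.Cor312ProvKIdeles
import HarnessLib

/-!
# Branch C — the NUMBER-LEVEL typed [IUTchIII] Cor. 3.12 in READING (U) (`T.Cor312Of`) EVALUATES TRUE, with NO hypothesis, at EVERY genuine
# Θ-volume datum of `283 + 5¹¹·13² = 2⁸·3⁸·17³` at EVERY prime level `l` (also `l = 5, 7, 11`), and of the Reyssat triple `2 + 3¹⁰·109 = 23⁵`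
# at EVERY prime level `l ≥ 151` (also `l = 151, 157, 163`)

PROOF-ONLY junction file (D-0012; no `def`, no new `Prop`, no instance, no notation; nothing re-typed) of the abc-iut cell — D-0079 RESCUE sub-cell R-W
«WINDOW Θ-SIDE INEQUALITY», seat abc-iut-W-num-6 (gen 3; row «W:INHABITED-BANDS», abc-iut-plan g10 C-R72, MINE 01:38:55Z). Pattern and words of
abc-iut-C-cert-3's `AbcOfSCor312OfAllLevels` (`Frey283.cor312Of_all`, `l ≥ 13`; `Reyssat.cor312Of_all`, `l ≥ 167`, over abc-iut-W-row-1's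
«W:INHABITED-BANDS-A» theorems), here fed with THIS seat's sharper uniform licences: `WRow.licence_frey283_uniform` (`InhUniformBandFrey283`, p488874 —
EVERY prime `l`, the wild different `D = 2e − 1` at `5` (abc-iut-W-neg-1) together with `l ∣ e` from the `l`-division layer covering `l = 5, 7, 11` too)
and `WRow.licence_reyssat_from151_uniform` (`InhUniformBandReyssat151`, p489529 — EVERY prime `l ≥ 151`: abc-iut-w4-d107's unconditional twist factor
`6·l ∣ e` at `23`, abc-iut-c312-5's integer-slot inner radius at the TAME prime `23`, and at `l = 151` the EXACT floor cell). As there, abc-iut-C-cert-3's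
`GenuineK.cor312Of_of_licence` (p435505) and abc-iut-s2-p6's Θ-descent `negLogTheta_settingPrVolSharp_pilotDataOfK_le_datum` (p447368) turn each licence
into the datum's NUMBER-level Corollary `T.Cor312Of`, the free binders instantiated at one-point data (abc-iut-c312-7's `unitSigDH/unitSplitDH/unitQDataDH/
unitLatticeDH`, `M := ℚ`) and at the realising ideles of [IUTchI] Ex. 3.2 (iv) (`Cor312Prov.exists_realising_{q,theta}Ideles_pilotDataOfK`).

* `Frey283.cor312Of_every {l} : ∀ T : ThetaVolumeDatumAt (ratPoint (283/8251953408)) l, T.Cor312Of` — the ENTIRE `λ`-fibre, no level bound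
  (the datum itself carries `l ≥ 5` prime);
* `Reyssat.cor312Of_from151 {l} (hl : 151 ≤ l) : ∀ T : ThetaVolumeDatumAt (ratPoint (2/23⁵)) l, T.Cor312Of` — on the datum form
  `ratPoint (((2 : ℕ) : ℚ) / (23 ^ 5 : ℕ))` of FINDINGS §Q (where, at `l = 13`, the M window binder is REFUTED; the K- and M-line refutations of the
  window clause hold at every `l ≤ 149`).

READING (numbers, no side): LINE-FREE — `T.Cor312Of` is the very proposition the K AND the M number binders (hNum*/hNumOff*/hNumJoint* and their M
twins) demand at `T`, so on these `(λ, l)`-families the number-binder instances of BOTH lines are theorems. This says NOTHING about Cor 3.12 in print,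
derives NO height bound (the [IUTchIV] 1.10 display at a known triple carries a constant ≈ 10⁸ nats; the cone binder `hregBad` is untouched, C-R52),
and is not a claim that abc is proved or refuted; no side taken on any author (Mochizuki / Scholze–Stix / Joshi / Dupuy–Hilado); inhabited-as-typed
≠ true-in-print; typed ≠ proved; instantiated ≠ endorsed.
[cite: Mochizuki2012, IUTchIII Cor. 3.12 p. 173–174, Step (xi-f) p. 184; IUTchIV Thm. 1.10 p. 22–23, Cor. 2.2 (ii) proof (P5)(P7) p. 46; IUTchI Ex. 3.2 (iv) p. 71]
[cite: DupuyHilado2025, §3.3, §3.4] [claim: Mochizuki2012, status: disputed] for every IUT sentence quoted.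
-/

noncomputable section

open Set Function NumberField IsDedekindDomain

namespace Summit.ABC.IUTFork.Conditional

open Thm311 Thm311.Real Cor312 Cor312Vol Cor312Prov Literature.IUT.LogThetaLattice Literature.IUT.LogVolume
  Literature.IUT.HodgeTheaters Literature.IUT.LogVolume.ThetaData Literature.IUT.LogVolume.Cor22
open Literature.NumberTheory.NumberFields Literature.NumberTheory.GaloisRepresentations.Ultrametric
open Literature.NumberTheory.DiophantineGeometry Literature.NumberTheory.DiophantineGeometry.GenEll Summit.ABC.ABC.Theorems

/-- **`T.Cor312Of` at EVERY genuine Θ-volume datum over `(ratPoint (283/8251953408), l)` for EVERY prime `l`, NO hypothesis** — the abc triple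
`283 + 5¹¹·13² = 2⁸·3⁸·17³` at EVERY level (`l = 5, 7, 11` included): this seat's `WRow.licence_frey283_uniform` (p488874) at one-point context data and
the realising ideles of [IUTchI] Ex. 3.2 (iv), through abc-iut-C-cert-3's `GenuineK.cor312Of_of_licence` (p435505) and the K-level Θ-side descent (p447368).
[cite: Mochizuki2012, IUTchIII Cor. 3.12 p. 173–174; IUTchIV Cor. 2.2 (ii) proof (P5) p. 46] [claim: Mochizuki2012, status: disputed] -/
theorem Frey283.cor312Of_every {l : ℕ} (T : Cor22.ThetaVolumeDatumAt (ratPoint ((283 : ℚ) / 8251953408)) l) : T.Cor312Of := by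
  letI := T.instFieldF; letI := T.instNumberFieldF; letI := T.instAlgebraF; letI := T.instFieldK
  letI := T.instNumberFieldK; letI := T.instAlgebraK; letI := T.instFieldFbar; letI := T.instAlgebraFbar
  letI := T.instAlgebraKFbar; letI := T.instIsElliptic
  obtain ⟨tq, htq0, htq1, htq⟩ := exists_realising_qIdeles_pilotDataOfK T.D
  obtain ⟨t, ht0, ht1, ht⟩ := exists_realising_thetaIdeles_pilotDataOfK T.D
  exact GenuineK.cor312Of_of_licence T.D T.K ℚ (fun _ _ => ∅) (fun _ _ => ∅) (fun _ _ _ => ∅) (fun _ _ _ => 0) (fun _ _ => ∅)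
    (fun _ _ _ _ => ∅) 0 unitLatticeDH (unitSigDH (pilotDataOfK T.D T.K)) (unitSplitDH (pilotDataOfK T.D T.K))
    (unitQDataDH (pilotDataOfK T.D T.K)) t tq T.isVolumeInputOf htq0 htq1 ht0 ht1 htq
    (WRow.licence_frey283_uniform T (logvAnalytic_analyticLogv (F := T.K)) ℚ (fun _ _ => ∅) (fun _ _ => ∅) (fun _ _ _ => ∅)
      (fun _ _ _ => 0) (fun _ _ => ∅) (fun _ _ _ _ => ∅) 0 unitLatticeDH (unitSigDH (pilotDataOfK T.D T.K)) (unitSplitDH (pilotDataOfK T.D T.K))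
      (unitQDataDH (pilotDataOfK T.D T.K)) tq t htq0 htq1 ht0 ht htq)
    (negLogTheta_settingPrVolSharp_pilotDataOfK_le_datum T ℚ (fun _ _ => ∅) (fun _ _ => ∅) (fun _ _ _ => ∅) (fun _ _ _ => 0) (fun _ _ => ∅)
      (fun _ _ _ _ => ∅) 0 unitLatticeDH (unitSigDH (pilotDataOfK T.D T.K)) (unitSplitDH (pilotDataOfK T.D T.K)) (unitQDataDH (pilotDataOfK T.D T.K))
      tq t htq0 htq1 ht0 ht)

/-- **`T.Cor312Of` at EVERY genuine Θ-volume datum over the REYSSAT point `(ratPoint (2/23⁵), l)` for EVERY prime `l ≥ 151`, NO hypothesis** — this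
seat's `WRow.licence_reyssat_from151_uniform` (p489529; the residual prime `l = 151` by the exact floor cell) through `GenuineK.cor312Of_of_licence` +
p447368, on the datum form of FINDINGS §Q. (At `l = 13` the window clause at Reyssat is REFUTED on both lines, FINDINGS §Q; the K- and M-line refutations
hold at every `l ≤ 149`; the number-level (U) statement here concerns the levels `l ≥ 151`, where S_H is INHABITED.) [cite: Mochizuki2012, IUTchIII Cor. 3.12
p. 173–174; IUTchIV Cor. 2.2 (ii) proof (P5) p. 46] [claim: Mochizuki2012, status: disputed] -/
theorem Reyssat.cor312Of_from151 {l : ℕ} (hl : 151 ≤ l) (T : Cor22.ThetaVolumeDatumAt (ratPoint (((2 : ℕ) : ℚ) / (23 ^ 5 : ℕ))) l) :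
    T.Cor312Of := by
  letI := T.instFieldF; letI := T.instNumberFieldF; letI := T.instAlgebraF; letI := T.instFieldK
  letI := T.instNumberFieldK; letI := T.instAlgebraK; letI := T.instFieldFbar; letI := T.instAlgebraFbar
  letI := T.instAlgebraKFbar; letI := T.instIsElliptic
  obtain ⟨tq, htq0, htq1, htq⟩ := exists_realising_qIdeles_pilotDataOfK T.D
  obtain ⟨t, ht0, ht1, ht⟩ := exists_realising_thetaIdeles_pilotDataOfK T.D
  exact GenuineK.cor312Of_of_licence T.D T.K ℚ (fun _ _ => ∅) (fun _ _ => ∅) (fun _ _ _ => ∅) (fun _ _ _ => 0) (fun _ _ => ∅)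
    (fun _ _ _ _ => ∅) 0 unitLatticeDH (unitSigDH (pilotDataOfK T.D T.K)) (unitSplitDH (pilotDataOfK T.D T.K))
    (unitQDataDH (pilotDataOfK T.D T.K)) t tq T.isVolumeInputOf htq0 htq1 ht0 ht1 htq
    (WRow.licence_reyssat_from151_uniform hl T (logvAnalytic_analyticLogv (F := T.K)) ℚ (fun _ _ => ∅) (fun _ _ => ∅) (fun _ _ _ => ∅)
      (fun _ _ _ => 0) (fun _ _ => ∅) (fun _ _ _ _ => ∅) 0 unitLatticeDH (unitSigDH (pilotDataOfK T.D T.K)) (unitSplitDH (pilotDataOfK T.D T.K))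
      (unitQDataDH (pilotDataOfK T.D T.K)) tq t htq0 htq1 ht0 ht htq)
    (negLogTheta_settingPrVolSharp_pilotDataOfK_le_datum T ℚ (fun _ _ => ∅) (fun _ _ => ∅) (fun _ _ _ => ∅) (fun _ _ _ => 0) (fun _ _ => ∅)
      (fun _ _ _ _ => ∅) 0 unitLatticeDH (unitSigDH (pilotDataOfK T.D T.K)) (unitSplitDH (pilotDataOfK T.D T.K)) (unitQDataDH (pilotDataOfK T.D T.K))
      tq t htq0 htq1 ht0 ht)

end Summit.ABC.IUTFork.Conditional

end
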